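import Literature.NumberTheory.Automorphic.UnitaryGroupHermitianSphereTransitive     -- ★ A-p10: quasi-reflections, Witt on non-isotropic level sets
import Mathlib.Topology.Algebra.Field
import Mathlib.Topology.Algebra.Constructions
import Mathlib.Topology.Instances.Matrix
import HarnessLib

/-!
# Local CONTINUOUS sections of the orbit map `g ↦ g v₁` of `U(σ, H)` on a hermitian sphere `{h(w,w) = β}`, `β ≠ 0`, and the consequence:
# `{g ∈ U ∣ g v₁ ∈ W}` lies in `C · Stab_U(v₁)` with `C` COMPACT, for every compact `W` on the sphere (N6nsGerm (S1), «compact mod M», file 1)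

Topic `NumberTheory/Automorphic`; namespace `Literature.NumberTheory.Automorphic.UnitaryGroup` (continues ★ A-p10's
`UnitaryGroupHermitianSphereTransitive`). KERNEL ONLY: theorems, no definition, no named fact, no instance, no notation, no `sorry`.
Cell `pub/hodgecm-mathlib` (LEAD F0P3a-plan (g9) T8-38 (1) ∕ T8-65 (2); road «N6nsGerm» (S1), binder (B4-top)(3) «compact mod `M`» of F0P2-p02 (g8)'s
junction in p08 (g13)'s Ad(M)-invariant reshape; census `F0/P3a/A-p16/g26/CENSUS-N6nsGerm-S1.A-p16g26.md` §5 road (F-sec)).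

THE POINT.  Harish-Chandra's descent at a singular semisimple `ε₀` integrates a cut-off over `{x ∣ x U_M x⁻¹ ∩ Ω ≠ ∅}`, which must be COMPACT MODULO
`M = Z(ε₀) = Stab(K v₁)` (`v₁` spanning the anisotropic `u`-eigenline of `ε₀`).  Since `x m x⁻¹ = ω` makes `x v₁` an eigenvector of `ω` of the fixed value
`β = h(v₁, v₁)`, that set is `{x ∣ x v₁ ∈ W}` for a compact `W` on the sphere `{h = β}` (file 2 «eigenvector compactness»).  This file proves, over ANY Hausdorff
topological field `K` with continuous inversion and continuous involution `σ`, for ANY hermitian `H` (no non-degeneracy) and `β ≠ 0`: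
«`W ⊆ {h = β}` compact ⇒ ∃ `C ⊆ U(σ,H)` compact with `{g ∈ U ∣ g v₁ ∈ W} ⊆ C · Stab_U(v₁)`» — by LOCAL CONTINUOUS SECTIONS of `g ↦ g v₁` built from TWO of
Dieudonné's quasi-reflections (★ `quasiRefl_mulVec`, ★ `exists_mem_unitaryGroupOfForm_mulVec_eq`): near `w₀ = g₀ v₁` the witness
`w ↦ q(−w₀ → w) · q₀ · g₀` (`q₀ w₀ = −w₀`; `q(−w₀ → w) = 1 + a(w) • (−w₀ − w) ⊗ hermRow(−w₀ − w)`, `a(w) = −h(w₀ + w, w₀)⁻¹`) is CONTINUOUS on the open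
`{h(w₀ + w, w₀) ≠ 0} ∋ w₀` (the one-step witness `q(w₀ → w)` degenerates at `w = w₀`; the detour through `−w₀` does not), and a finite subcover of `W` assembles `C`.

* §1 `continuous_hermRow`, `continuous_hermForm`; **`exists_continuousOn_section_nhds`** — the `↥U(σ,H)`-valued local section at `w₀`: `ContinuousOn s (O ∩ {h = β})`,
  `s w · v₁ = w` (the explicit two-sided quasi-reflection data `(Q(w), Q′(w))` is continuous in `w`).
* §2 **`exists_isCompact_forall_mulVec_mem_imp`** — the compact `C` with `{g ∣ g v₁ ∈ W} ⊆ C · Stab_U(v₁)` (stated as `∃ c ∈ C, (c⁻¹ g) v₁ = v₁`).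

HONEST SCOPE.  Hermitian linear algebra + point-set topology only.  HC_CM is proved only modulo the printed citations until rung 0 closes; this file discharges no printed
statement.

## References
* [Dieudonne1971GroupesClassiques] J. Dieudonné, *La géométrie des groupes classiques*, 3e éd. (1971), Chap. II §4 n° 7–8 (quasi-symétries; Witt's theorem for hermitian lines).
* [HarishChandra1970] Harish-Chandra (notes by G. van Dijk), *Harmonic Analysis on Reductive p-adic Groups*, LNM 162 (1970), Part I §3 Lemma 19 ∕ Part II §5 (compactness
  modulo the centraliser in the descent).
-/

set_option autoImplicit false

noncomputable section

open Set Filter Topology Matrix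

namespace Literature.NumberTheory.Automorphic.UnitaryGroup

variable {K : Type*} [Field K] [TopologicalSpace K] [IsTopologicalRing K] [ContinuousInv₀ K] [T2Space K]
  (σ : K →+* K) {n : Type*} [Fintype n] [DecidableEq n] (H : Matrix n n K)

/-! ## §1 The two-step quasi-reflection witness is continuous -/

omit [ContinuousInv₀ K] [T2Space K] [DecidableEq n] in
/-- `v ↦ hermRow σ H v = (σ ∘ v) ᵥ* H` is continuous (for continuous `σ`). [cite: Dieudonne1971GroupesClassiques, Chap. II §4] -/
theorem continuous_hermRow (hσc : Continuous σ) : Continuous fun v : n → K => hermRow σ H v := by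
  have h1 : Continuous fun v : n → K => (⇑σ ∘ v : n → K) := continuous_pi fun i => hσc.comp (continuous_apply i)
  exact h1.matrix_vecMul continuous_const

omit [ContinuousInv₀ K] [T2Space K] [DecidableEq n] in
/-- `(v, z) ↦ h(v, z)` is continuous (for continuous `σ`). [cite: Dieudonne1971GroupesClassiques, Chap. II §4] -/
theorem continuous_hermForm (hσc : Continuous σ) : Continuous fun p : (n → K) × (n → K) => hermForm σ H p.1 p.2 := by
  have h : ∀ p : (n → K) × (n → K), hermForm σ H p.1 p.2 = hermRow σ H p.1 ⬝ᵥ p.2 := fun p => (hermRow_dotProduct σ H p.1 p.2).symm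
  simp_rw [h]
  exact ((continuous_hermRow σ H hσc).comp continuous_fst).dotProduct continuous_snd

/-- **The local section at `w₀`.** `σ` a continuous involution, `H` hermitian, `2 ≠ 0`, `β = h(v₁, v₁) ≠ 0`, `h(w₀, w₀) = β`.  There are an open `O ∋ w₀` and
`s : (n → K) → ↥U(σ, H)`, continuous on `O ∩ {h(w, w) = β}`, with `s(w) v₁ = w` there.  (Witt ★ gives `g₀ v₁ = w₀` and `q₀ w₀ = −w₀`; on
`O = {h(w₀ + w, w₀) ≠ 0}` the quasi-reflection `1 + a(w) • (−w₀ − w) ⊗ hermRow(−w₀ − w)`, `a(w) = −h(−w₀ − w, −w₀)⁻¹`, maps `−w₀ ↦ w` and depends continuously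
on `w`, as does its inverse `1 + σ a(w) • …`.) [cite: Dieudonne1971GroupesClassiques, Chap. II §4 n° 7–8] -/
theorem exists_continuousOn_section_nhds (hσ : ∀ s, σ (σ s) = s) (hσc : Continuous σ) (hH : (H.map σ)ᵀ = H) (h2 : (2 : K) ≠ 0)
    {v₁ w₀ : n → K} (hβ : hermForm σ H v₁ v₁ ≠ 0) (hw₀ : hermForm σ H w₀ w₀ = hermForm σ H v₁ v₁) :
    ∃ O : Set (n → K), IsOpen O ∧ w₀ ∈ O ∧ ∃ s : (n → K) → ↥(unitaryGroupOfForm σ H),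
      ContinuousOn s (O ∩ {w | hermForm σ H w w = hermForm σ H v₁ v₁}) ∧
      ∀ w ∈ O, hermForm σ H w w = hermForm σ H v₁ v₁ → (((s w : ↥(unitaryGroupOfForm σ H)) : GL n K) : Matrix n n K) *ᵥ v₁ = w := by
  classical
  set β : K := hermForm σ H v₁ v₁ with hβdef
  -- the two fixed steps `v₁ ↦ w₀ ↦ −w₀`
  obtain ⟨g₀, hg₀, hg₀v⟩ := exists_mem_unitaryGroupOfForm_mulVec_eq σ H hσ hH h2 (x := v₁) (y := w₀) rfl hw₀ hβ
  have hw₀0 : hermForm σ H w₀ w₀ ≠ 0 := by rw [hw₀]; exact hβ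
  obtain ⟨q₀, hq₀, hq₀w⟩ := exists_mem_unitaryGroupOfForm_mulVec_eq_neg σ H hσ hH (map_ofNat σ 2) hw₀0
  -- the moving step `−w₀ ↦ w`
  let c : (n → K) → K := fun w => hermForm σ H (-w₀ - w) (-w₀)
  let a : (n → K) → K := fun w => -(c w)⁻¹
  let Q : (n → K) → Matrix n n K := fun w => 1 + a w • Matrix.vecMulVec (-w₀ - w) (hermRow σ H (-w₀ - w))
  let Q' : (n → K) → Matrix n n K := fun w => 1 + σ (a w) • Matrix.vecMulVec (-w₀ - w) (hermRow σ H (-w₀ - w))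
  set O : Set (n → K) := {w | c w ≠ 0} with hO
  have hcc : Continuous c := (continuous_hermForm σ H hσc).comp ((continuous_const.sub continuous_id).prodMk continuous_const)
  have hOo : IsOpen O := isOpen_ne_fun hcc continuous_const
  have hw₀O : w₀ ∈ O := by
    show hermForm σ H (-w₀ - w₀) (-w₀) ≠ 0
    have h1 : hermForm σ H (-w₀ - w₀) (-w₀) = 2 * hermForm σ H w₀ w₀ := by
      rw [hermForm_sub_left, hermForm_neg_left, hermForm_neg_right, neg_neg, sub_neg_eq_add, two_mul]
    rw [h1, hw₀]
    exact mul_ne_zero h2 hβ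
  -- Dieudonné's relation on `O ∩ {h = β}`
  have hrel : ∀ w ∈ O, hermForm σ H w w = β → a w + σ (a w) + a w * σ (a w) * hermForm σ H (-w₀ - w) (-w₀ - w) = 0 := by
    intro w hw hwβ
    have hxy : hermForm σ H (-w₀) (-w₀) = hermForm σ H w w := by
      rw [hermForm_neg_left, hermForm_neg_right, neg_neg, hw₀, hwβ]
    have hcw : c w ≠ 0 := hw
    have hkey := hermForm_sub_sub_eq σ H hσ hH hxy
    -- `a = −c⁻¹`
    have hσc0 : σ (c w) ≠ 0 := (map_ne_zero σ).2 hcw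
    show -(c w)⁻¹ + σ (-(c w)⁻¹) + -(c w)⁻¹ * σ (-(c w)⁻¹) * hermForm σ H (-w₀ - w) (-w₀ - w) = 0
    rw [hkey, map_neg, map_inv₀]
    field_simp
    ring
  have hQQ' : ∀ w ∈ O, hermForm σ H w w = β → Q w * Q' w = 1 := fun w hw hwβ => quasiRefl_mul_quasiRefl_conj σ H (hrel w hw hwβ)
  have hQ'Q : ∀ w ∈ O, hermForm σ H w w = β → Q' w * Q w = 1 := fun w hw hwβ => quasiRefl_conj_mul_quasiRefl σ H (hrel w hw hwβ)
  have hQmem : ∀ w (hw : w ∈ O) (hwβ : hermForm σ H w w = β),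
      (⟨Q w, Q' w, hQQ' w hw hwβ, hQ'Q w hw hwβ⟩ : GL n K) ∈ unitaryGroupOfForm σ H := fun w hw hwβ => by
    rw [mem_unitaryGroupOfForm_iff_hermForm]
    exact hermForm_quasiRefl_mulVec σ H hσ hH (hrel w hw hwβ)
  have hQv : ∀ w ∈ O, hermForm σ H w w = β → Q w *ᵥ (-w₀) = w := by
    intro w hw hwβ
    show (1 + a w • Matrix.vecMulVec (-w₀ - w) (hermRow σ H (-w₀ - w))) *ᵥ (-w₀) = w
    rw [quasiRefl_mulVec]
    show -w₀ + (-(c w)⁻¹ * c w) • (-w₀ - w) = w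
    rw [neg_mul, inv_mul_cancel₀ hw, neg_smul, one_smul]
    abel
  -- the section
  let s : (n → K) → ↥(unitaryGroupOfForm σ H) := fun w =>
    if h : w ∈ O ∧ hermForm σ H w w = β then ⟨⟨Q w, Q' w, hQQ' w h.1 h.2, hQ'Q w h.1 h.2⟩, hQmem w h.1 h.2⟩ * (⟨q₀, hq₀⟩ * ⟨g₀, hg₀⟩) else 1
  refine ⟨O, hOo, hw₀O, s, ?_, ?_⟩
  · -- continuity on `O ∩ {h = β}`: both matrices `Q`, `Q′` are continuous
    have hvv : Continuous fun w : n → K => Matrix.vecMulVec (-w₀ - w) (hermRow σ H (-w₀ - w)) :=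
      (continuous_const.sub continuous_id).matrix_vecMulVec ((continuous_hermRow σ H hσc).comp (continuous_const.sub continuous_id))
    have hac : ContinuousOn a O := (hcc.continuousOn.inv₀ fun w hw => hw).neg
    have hQc : ContinuousOn Q O := (continuousOn_const.add (hac.smul hvv.continuousOn))
    have hQ'c : ContinuousOn Q' O := (continuousOn_const.add ((hσc.comp_continuousOn hac).smul hvv.continuousOn))
    rw [continuousOn_iff_continuous_restrict]
    have hD : ∀ w : ↥(O ∩ {w | hermForm σ H w w = hermForm σ H v₁ v₁}), (w : n → K) ∈ O ∧ hermForm σ H w w = β := fun w => ⟨w.2.1, w.2.2⟩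
    have hsr : (O ∩ {w | hermForm σ H w w = hermForm σ H v₁ v₁}).restrict s =
        fun w : ↥(O ∩ {w | hermForm σ H w w = hermForm σ H v₁ v₁}) =>
          (⟨⟨Q (w : n → K), Q' (w : n → K), hQQ' (w : n → K) (hD w).1 (hD w).2, hQ'Q (w : n → K) (hD w).1 (hD w).2⟩,
              hQmem (w : n → K) (hD w).1 (hD w).2⟩ : ↥(unitaryGroupOfForm σ H)) *
            (⟨q₀, hq₀⟩ * ⟨g₀, hg₀⟩) := by
      funext w
      show s w = _
      simp only [s, dif_pos (hD w)]
    rw [hsr]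
    refine Continuous.mul ?_ continuous_const
    refine Continuous.subtype_mk ?_ _
    rw [Units.continuous_iff]
    exact ⟨hQc.comp_continuous continuous_subtype_val fun w => (hD w).1, hQ'c.comp_continuous continuous_subtype_val fun w => (hD w).1⟩
  · -- the value on `O ∩ {h = β}`
    intro w hw hwβ
    have h : w ∈ O ∧ hermForm σ H w w = β := ⟨hw, hwβ⟩
    show ((((s w : ↥(unitaryGroupOfForm σ H)) : GL n K) : Matrix n n K)) *ᵥ v₁ = w
    simp only [s, dif_pos h, Subgroup.coe_mul, Units.val_mul]
    show (Q w * ((q₀ : Matrix n n K) * (g₀ : Matrix n n K))) *ᵥ v₁ = w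
    rw [← Matrix.mulVec_mulVec, ← Matrix.mulVec_mulVec, hg₀v, hq₀w, hQv w hw hwβ]

/-! ## §2 Preimages of compact sets under the orbit map are compact modulo the stabiliser -/

/-- **`{g ∈ U(σ,H) ∣ g v₁ ∈ W} ⊆ C · Stab_U(v₁)` with `C` COMPACT**, for `W` a compact subset of the sphere `{h(w, w) = h(v₁, v₁)}`, `h(v₁, v₁) ≠ 0` (finitely many
local sections of §1 over a closed-neighbourhood refinement of a finite subcover of `W`).  With `Stab_U(v₁) ≤ Stab_U(K v₁) = Z(ε₀)` this is the «compact modulo `M`» input of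
Harish-Chandra's descent once the relevant `g v₁` are known to range in a compact `W` (file 2). [cite: HarishChandra1970, Part I §3 Lemma 19; Part II §5]
[cite: Dieudonne1971GroupesClassiques, Chap. II §4 n° 7–8] -/
theorem exists_isCompact_forall_mulVec_mem_imp (hσ : ∀ s, σ (σ s) = s) (hσc : Continuous σ) (hH : (H.map σ)ᵀ = H) (h2 : (2 : K) ≠ 0)
    {v₁ : n → K} (hβ : hermForm σ H v₁ v₁ ≠ 0) {W : Set (n → K)} (hW : IsCompact W) (hWβ : ∀ w ∈ W, hermForm σ H w w = hermForm σ H v₁ v₁) :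
    ∃ C : Set ↥(unitaryGroupOfForm σ H), IsCompact C ∧
      ∀ g : ↥(unitaryGroupOfForm σ H), ((g : GL n K) : Matrix n n K) *ᵥ v₁ ∈ W →
        ∃ c ∈ C, ((((c⁻¹ * g : ↥(unitaryGroupOfForm σ H))) : GL n K) : Matrix n n K) *ᵥ v₁ = v₁ := by
  classical
  -- local sections and closed neighbourhoods inside their domains
  have hsec : ∀ w₀ ∈ W, ∃ O : Set (n → K), IsOpen O ∧ w₀ ∈ O ∧ ∃ s : (n → K) → ↥(unitaryGroupOfForm σ H),
      ContinuousOn s (O ∩ {w | hermForm σ H w w = hermForm σ H v₁ v₁}) ∧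
      ∀ w ∈ O, hermForm σ H w w = hermForm σ H v₁ v₁ → (((s w : ↥(unitaryGroupOfForm σ H)) : GL n K) : Matrix n n K) *ᵥ v₁ = w :=
    fun w₀ hw₀ => exists_continuousOn_section_nhds σ H hσ hσc hH h2 hβ (hWβ w₀ hw₀)
  choose! O hOo hwO s hsc hsv using hsec
  have hF : ∀ w₀ ∈ W, ∃ F : Set (n → K), F ∈ 𝓝 w₀ ∧ IsClosed F ∧ F ⊆ O w₀ :=
    fun w₀ hw₀ => exists_mem_nhds_isClosed_subset ((hOo w₀ hw₀).mem_nhds (hwO w₀ hw₀))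
  choose! F hFn hFc hFO using hF
  obtain ⟨t, htW, hcover⟩ := hW.elim_nhds_subcover (fun w => F w) (fun w hw => hFn w hw)
  -- the compact `C = ⋃_{w₀ ∈ t} s_{w₀}(W ∩ F_{w₀})`
  refine ⟨⋃ w₀ ∈ t, s w₀ '' (W ∩ F w₀), ?_, ?_⟩
  · refine t.finite_toSet.isCompact_biUnion fun w₀ hw₀ => ?_
    have hw₀W : w₀ ∈ W := htW w₀ hw₀
    refine ((hW.inter_right (hFc w₀ hw₀W)).image_of_continuousOn ((hsc w₀ hw₀W).mono ?_))
    exact fun w hw => ⟨hFO w₀ hw₀W hw.2, hWβ w hw.1⟩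
  · intro g hg
    obtain ⟨w₀, hw₀t, hgF⟩ := Set.mem_iUnion₂.1 (hcover hg)
    have hw₀W : w₀ ∈ W := htW w₀ hw₀t
    refine ⟨s w₀ (((g : GL n K) : Matrix n n K) *ᵥ v₁), Set.mem_iUnion₂.2 ⟨w₀, hw₀t, _, ⟨hg, hgF⟩, rfl⟩, ?_⟩
    have hsv' := hsv w₀ hw₀W _ (hFO w₀ hw₀W hgF) (hWβ _ hg)
    -- `c v₁ = g v₁` ⇒ `(c⁻¹ g) v₁ = v₁`
    set c := s w₀ (((g : GL n K) : Matrix n n K) *ᵥ v₁) with hc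
    have hcinv : (((c⁻¹ : ↥(unitaryGroupOfForm σ H)) : GL n K) : Matrix n n K) *ᵥ ((((c : ↥(unitaryGroupOfForm σ H)) : GL n K) : Matrix n n K) *ᵥ v₁) = v₁ := by
      rw [Matrix.mulVec_mulVec, Subgroup.coe_inv, ← Units.val_mul, inv_mul_cancel, Units.val_one, Matrix.one_mulVec]
    rw [Subgroup.coe_mul, Units.val_mul, ← Matrix.mulVec_mulVec, ← hsv', hcinv]

end Literature.NumberTheory.Automorphic.UnitaryGroup
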